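import Literature.IUT.LogThetaLattice.TensorPacketsProofs
import Mathlib.Algebra.DualNumber
import HarnessLib

/-!
# [IUTchIII] Proposition 3.1 (i): the unprimed finite-level predicates are SCHEMAS — universal-closure certificates (proofs only)

S. Mochizuki, *Inter-universal Teichmüller theory III*, kurims manuscript (May 2020), §3, Proposition 3.1 "(Local Holomorphic Tensor
Packets)" (i) "(Ring Structures)", p. 93 [claim: Mochizuki2012, status: disputed] (D-0012 claim key; the content proved here is
elementary). abc-iut cell, block F (seat abc-iut-f-130 gen 7; director-abc g4 row supply `ROWS-LF-0348.tsv` «decide the label»); frozen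
FACT-LIST rows **F-2123** `Prop31i_ringStructures` and **F-2122** `Prop31i_locallyProductOfFields` (abc-iut-L6-t3, `TensorPackets.lean`),
node **IUTchIII:Prop3.1(i)**. PROOF-ONLY (no `def`, no `instance`; nothing of the statement file is re-typed); pattern of abc-iut-w5-d230's
`GlobalPacketsLGPProp33iiSchemaClosures.lean` and of the primed-schema certificate `TensorPacketsModelSchemaNegative.lean`
(`not_forall_prop31i_ringStructures'`, infinite fibre).

Both predicates are typed over ARBITRARY commutative `𝕜`-algebras `L α v` (RQ7 finding L6-F1: "a SCHEMA … FALSE at junk parameters").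
Kernel form of that finding, at the smallest junk parameter: `𝕜 = ℚ`, `A = Vfib = Unit`, `L α v := ℚ[ε]` (Mathlib `DualNumber ℚ`). The pure
tensor `⊗ ε` of the packet `log(^A𝓕_{v_ℚ}) = ⊗_{Unit} (Unit → ℚ[ε])` is NONZERO (`PiTensorProduct.subsingletonEquiv`) and NILPOTENT
(`ε² = 0`), whereas a finite product of fields — and anything ring-embedded in one — is reduced:

* F-2123 — `not_forall_prop31i_ringStructures`; instance `exists_prop31i_ringStructures` (`L ≡ ℚ`, `Prop31i_ringStructures_of_field_charZero`).
* F-2122 — `not_forall_prop31i_locallyProductOfFields` (the finite set `{⊗ ε}` lies in no subalgebra that is a product of fields);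
  instance `exists_prop31i_locallyProductOfFields` (`Prop31i_locallyProductOfFields_of_ringStructures`).

HONEST FRAMING: a refuted universal closure is a statement about OUR typing (the predicates admit non-field algebras), not about the
printed proposition at the genuine data `log(^α𝓕_v) ≅ k̄` (instance forms of record: `Prop31i_ringStructures_of_field(_charZero)`,
`prop31i_ringStructures'_model`, `Prop31i_locallyProductOfFields_algebraicClosure`). Nothing here bears on [IUTchIII] Cor. 3.12 or takes
a side; typed ≠ proved; nothing asserts abc proved or refuted.
-/

noncomputable section

namespace Literature.IUT.LogThetaLattice

open PiTensorProduct

/-- The junk packet: over `𝕜 = ℚ` with one capsule index and one place, `L α v := ℚ[ε]`; its pure tensor `x := ⊗ ε` is nonzero and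
squares to zero. [claim: Mochizuki2012, status: disputed] (IUTchIII §3 Prop 3.1 (i), kurims p.93) -/
private theorem exists_ne_zero_sq_eq_zero :
    ∃ x : PacketN ℚ (fun (_ : Unit) (_ : Unit) => DualNumber ℚ), x ≠ 0 ∧ x * x = 0 := by
  let f : Unit → Packet1 (fun (_ : Unit) (_ : Unit) => DualNumber ℚ) () := fun _ _ => DualNumber.eps
  refine ⟨tprod ℚ f, fun hx => ?_, ?_⟩
  · have h := congrArg (PiTensorProduct.subsingletonEquiv (R := ℚ) ()) hx
    rw [subsingletonEquiv_apply_tprod, map_zero] at h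
    have h1 : (DualNumber.eps : DualNumber ℚ) = 0 := congrFun h ()
    have h2 := congrArg TrivSqZeroExt.snd h1
    rw [DualNumber.snd_eps, TrivSqZeroExt.snd_zero] at h2
    exact one_ne_zero h2
  · rw [tprod_mul_tprod]
    have hf : f * f = 0 := by
      funext a v
      exact DualNumber.eps_mul_eps
    rw [hf]
    exact (tprod ℚ).map_zero

/-! ## F-2123 `Prop31i_ringStructures` ([IUTchIII] Prop 3.1 (i), finite level, unprimed) -/

/-- **F-2123 is a schema**: the universal closure of `Prop31i_ringStructures` (over all base fields, index types and commutative
algebras) is FALSE — at `L ≡ ℚ[ε]` the packet has a nonzero nilpotent, so it is not ring-isomorphic to a finite product of fields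
(reduced). Instance forms of record: `Prop31i_ringStructures_of_field`, `Prop31i_ringStructures_of_field_charZero`.
[claim: Mochizuki2012, status: disputed] (IUTchIII §3 Prop 3.1 (i), kurims p.93) -/
theorem not_forall_prop31i_ringStructures :
    ¬ ∀ (𝕜 : Type) [Field 𝕜] (A Vfib : Type) (L : A → Vfib → Type) [∀ α v, CommRing (L α v)] [∀ α v, Algebra 𝕜 (L α v)],
        Prop31i_ringStructures 𝕜 L := by
  intro h
  obtain ⟨ι, hι, K, hK, ⟨e⟩⟩ := h ℚ Unit Unit (fun _ _ => DualNumber ℚ)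
  obtain ⟨x, hx0, hxx⟩ := exists_ne_zero_sq_eq_zero
  haveI : IsReduced (PacketN ℚ (fun (_ : Unit) (_ : Unit) => DualNumber ℚ)) :=
    isReduced_of_injective e.toRingHom e.injective
  exact hx0 (IsReduced.eq_zero x ⟨2, by rw [pow_two, hxx]⟩)

/-- **F-2123, INHABITED**: at `L ≡ ℚ` (one index, one place) the packet is a finite product of fields
(`Prop31i_ringStructures_of_field_charZero`, by name). [claim: Mochizuki2012, status: disputed] (IUTchIII §3 Prop 3.1 (i), kurims p.93) -/
theorem exists_prop31i_ringStructures :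
    ∃ (𝕜 : Type) (_ : Field 𝕜) (A Vfib : Type) (L : A → Vfib → Type) (_ : ∀ α v, CommRing (L α v)) (_ : ∀ α v, Algebra 𝕜 (L α v)),
        Prop31i_ringStructures 𝕜 L :=
  ⟨ℚ, inferInstance, Unit, Unit, fun _ _ => ℚ, inferInstance, inferInstance,
    Prop31i_ringStructures_of_field_charZero ℚ (fun (_ : Unit) (_ : Unit) => ℚ)⟩

/-! ## F-2122 `Prop31i_locallyProductOfFields` ([IUTchIII] Prop 3.1 (i), model-level "locally a product of fields") -/

/-- **F-2122 is a schema**: the universal closure of `Prop31i_locallyProductOfFields` is FALSE — at `L ≡ ℚ[ε]` the finite set `{⊗ ε}`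
lies in no `ℚ`-subalgebra ring-isomorphic to a finite product of fields (such a subalgebra would be reduced, but contains the nonzero
nilpotent `⊗ ε`). Instance forms of record: `Prop31i_locallyProductOfFields_of_isSeparable`, `Prop31i_locallyProductOfFields_algebraicClosure`.
[claim: Mochizuki2012, status: disputed] (IUTchIII §3 Prop 3.1 (i), kurims p.93) -/
theorem not_forall_prop31i_locallyProductOfFields :
    ¬ ∀ (𝕜 : Type) [Field 𝕜] (A Vfib : Type) (L : A → Vfib → Type) [∀ α v, CommRing (L α v)] [∀ α v, Algebra 𝕜 (L α v)],
        Prop31i_locallyProductOfFields 𝕜 L := by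
  intro h
  obtain ⟨x, hx0, hxx⟩ := exists_ne_zero_sq_eq_zero
  obtain ⟨B, hB, ι, hι, K, hK, ⟨e⟩⟩ := h ℚ Unit Unit (fun _ _ => DualNumber ℚ) {x}
  have hxB : x ∈ B := hB (Finset.mem_coe.mpr (Finset.mem_singleton_self x))
  haveI : IsReduced B := isReduced_of_injective e.toRingHom e.injective
  have h0 : (⟨x, hxB⟩ : B) = 0 :=
    IsReduced.eq_zero _ ⟨2, Subtype.ext (by rw [pow_two]; exact hxx)⟩
  exact hx0 (congrArg Subtype.val h0)

/-- **F-2122, INHABITED**: at `L ≡ ℚ` the model-level predicate holds (`B = ⊤`, from the finite-level instance via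
`Prop31i_locallyProductOfFields_of_ringStructures`). [claim: Mochizuki2012, status: disputed] (IUTchIII §3 Prop 3.1 (i), kurims p.93) -/
theorem exists_prop31i_locallyProductOfFields :
    ∃ (𝕜 : Type) (_ : Field 𝕜) (A Vfib : Type) (L : A → Vfib → Type) (_ : ∀ α v, CommRing (L α v)) (_ : ∀ α v, Algebra 𝕜 (L α v)),
        Prop31i_locallyProductOfFields 𝕜 L :=
  ⟨ℚ, inferInstance, Unit, Unit, fun _ _ => ℚ, inferInstance, inferInstance,
    Prop31i_locallyProductOfFields_of_ringStructures ℚ _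
      (Prop31i_ringStructures_of_field_charZero ℚ (fun (_ : Unit) (_ : Unit) => ℚ))⟩

end Literature.IUT.LogThetaLattice

end
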